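import Literature.AnabelianGeometry.EtaleTheta.Discharge.Sec1DeltaYEllClosureOfDeltaTheta
import Literature.AnabelianGeometry.EtaleTheta.Discharge.Sec1ClosureDeltaYZHat
import Literature.AnabelianGeometry.EtaleTheta.CyclotomeZHatEquiv
import HarnessLib

/-!
# [EtTh] §1 p. 12, typed cyclotomic package (FACT-LIST F-0657 / F-0658 / F-0659 / F-1697): for data with
# Galois-trivial action on `Δ^ell_X`, "`(Δ^tp_Y)^ell ≅ Ẑ(1)`" holds IFF `G_K` fixes every root of unity of `K̄`

Mochizuki, *The étale theta function and its Frobenioid-theoretic manifestations*, Publ. RIMS **45** (2009)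
[EtTh], §1, PRIMS PDF p. 12 (printed p. 238): "`1 → Ẑ(1) → Δ^ell_X → Ẑ → 1` … `(Ẑ(1) ≅) Δ_Θ ⊆ Δ^Θ_X` … Thus,
`(Δ^tp_Y)^ell ≅ Ẑ(1)`" [cite: MochizukiEtTh2009, §1 p.12], typed by abc-iut-L3 (`SemiGraphs/TemperedCyclotomic.lean`)
as predicates on the origin binder whose common body is: the closed `Π^tp_X`-stable subgroup `T ≤ Δ^ell_X` with carrier
the closure of the image of `Δ^tp_Y` is a Tate twist (`IsTateTwist`: compatible, jointly injective, continuous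
surjections `T ↠ μ_n(K̄)`, `Π^tp_X`-equivariant for `G_K` acting on `μ_n(K̄) ⊆ K̄`).

abc-iut cell, block F (FACT-PROVING WAVE), seat abc-iut-f-172 (gen 3); PROOF-ONLY (no `def`, no `instance`, no named
fact; abc-iut-L2-t7's `DeltaEllZHat.nonempty_mulEquiv_zHat_of_coe_eq_closure`, abc-iut-f-172 gen 2's
`OncePuncturedCyclotomic.exists_closed_stable_closureDeltaY`, abc-iut-w4-d024/w5-d091's `cyclotome.exists_generator`
consumed BY NAME, nothing restated).

WHAT IS PROVED — the KERNEL LOCUS of the four rows (`K : Type`, characteristic `0`). For every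
`D : OncePuncturedTemperedGroup K` on whose `Δ^ell_X` the conjugation action of `Π^tp_X` is TRIVIAL (e.g. every split /
product datum `Π = Γ × G_K`, abc-iut-w5-d218 / w6-d060; `Δ^tp_X` always acts trivially) and every `T ≤ Δ^ell_X` with the
F-1697 carrier:
* `isTateTwist_iff_gal_fixes_rootsOfUnity_of_conjDeltaEll_eq_self` — **`T` is a Tate twist `Ẑ(1)` IFF every
  `σ ∈ G_K = Gal(K̄/K)` fixes every root of unity of `K̄`.** (⟹) the level maps are ONTO `μ_n(K̄)` and equivariant for a
  trivial action; (⟸) `e : T ≃* Ẑ` (abstract, abc-iut-L2-t7) and a cyclotome generator `ξ` give level maps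
  `t ↦ ξ_n ^ level_n(e t)` whose kernels are the images of the `n`-th power maps of the compact group `T` (closed of
  finite index, hence open).
* `not_isTateTwist_of_gal_moves_rootOfUnity`, `exists_isTateTwist_closureDeltaY_of_gal_fixes_rootsOfUnity` — the two
  halves as usable statements (the first generalises the mechanism of abc-iut-w6-d060's `ℚ₃` refutation
  `TemperedCyclotomicClosures.lean` to any field; the second generalises the `G_K = 1` witness of
  `Sec1CyclotomicPackageTrivialGalois.lean`).
So, in the kernel, the arithmetic content of F-0657/F-0658/F-0659/F-1697 is EXACTLY the cyclotomic character: for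
Galois-trivial data the typed package says "`K ⊇ μ_∞(K̄)`", nothing else.

HONEST FRAMING: statements about OUR typed predicates on abstract data; [EtTh] is refereed and nothing of it is asserted
or disputed; nothing bears on [IUTchIII] Cor. 3.12; typed ≠ proved; no side is taken on any disputed claim.
-/

noncomputable section

namespace Literature.AnabelianGeometry.EtaleTheta

open Literature.AnabelianGeometry.SemiGraphs
open _root_.Topology
open scoped commutatorElement
open CategoryTheory ProfiniteGrp ProfiniteGrp.ProfiniteCompletion

namespace OncePuncturedCyclotomic

variable {K : Type} [Field K] (D : OncePuncturedTemperedGroup K)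

/-- **Kernel locus of "`(Δ^tp_Y)^ell ≅ Ẑ(1)`" for Galois-trivial data** ([EtTh] p. 12; FACT-LIST F-1697 body, hence
F-0657/F-0658/F-0659 by the landed reductions). Let `K` have characteristic `0`, let `D : OncePuncturedTemperedGroup K`
have `Π^tp_X` acting TRIVIALLY on `Δ^ell_X`, and let `T ≤ Δ^ell_X` have carrier the closure of the image of `Δ^tp_Y`.
Then `T` (with the conjugation action) is a Tate twist `Ẑ(1)` IFF every `σ ∈ Gal(K̄/K)` fixes every root of unity of
`K̄`. (⟹): for `ζ ∈ μ_n(K̄)` and `σ = aug g`, pick `t` with `ι_n t = ζ` (surjectivity); equivariance with `g · t = t`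
reads `ζ = σ ζ`. (⟸): `T` is compact (closed in the compact Hausdorff `Δ^ell_X`) and `≃* Ẑ` abstractly; with a
compatible system `ξ` of primitive roots of unity put `ι_n t := ξ_n ^ level_n(e t)`: torsion, compatibility,
surjectivity onto `⟨ξ_n⟩ = μ_n(K̄)` and joint injectivity (`Ẑ ↪ lim ℤ/n`) are formal, `Ker ι_n =` image of the `n`-th
power map (`Ker(Ẑ → ℤ/n) = Ẑ^n`) is closed of finite index hence open, and both sides of the equivariance identity
equal `ι_n t`. [cite: MochizukiEtTh2009, §1 p.12] -/
theorem isTateTwist_iff_gal_fixes_rootsOfUnity_of_conjDeltaEll_eq_self [CharZero K]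
    (htriv : ∀ (g : D.Pi) (x : D.DeltaEll), D.conjDeltaEll g x = x)
    (T : Subgroup D.DeltaEll) (hT : ∀ g, ∀ t ∈ T, D.conjDeltaEll g t ∈ T) (hTc : IsClosed (T : Set D.DeltaEll))
    (hTset : (T : Set D.DeltaEll) = closure ((fun δ : D.delta =>
      (QuotientGroup.mk ⟨D.toHat δ, Subgroup.le_topologicalClosure _ ⟨δ, δ.2, rfl⟩⟩ : D.DeltaEll)) ''
        {δ | (δ : D.Pi) ∈ D.piY})) :
    D.IsTateTwist T D.conjDeltaEll hT ↔
      ∀ (σ : Field.absoluteGaloisGroup K) (n : ℕ), 0 < n → ∀ ζ : AlgebraicClosure K, ζ ^ n = 1 →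
        OncePuncturedTemperedGroup.galApply σ ζ = ζ := by
  classical
  constructor
  · -- (⟹) the level maps are onto `μ_n(K̄)` and equivariant for a trivial action
    rintro ⟨ι, h1, h2, -, -, -, h6⟩ σ n hn ζ hζ
    obtain ⟨g, rfl⟩ := D.aug_surjective σ
    have hu : IsUnit ζ := IsUnit.of_pow_eq_one hζ hn.ne'
    obtain ⟨t, ht⟩ := h2 n hn hu.unit (Units.ext (by rw [Units.val_pow_eq_pow_val, hu.unit_spec, hζ, Units.val_one]))
    have hgt : (⟨D.conjDeltaEll g t, hT g t t.2⟩ : ↥T) = t := Subtype.ext (htriv g t)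
    have h := h6 n hn g t
    rw [hgt, ht, hu.unit_spec] at h
    exact h.symm
  · -- (⟸) the construction
    intro hfix
    -- topology: `Δ^ell_X` is compact Hausdorff, `T` is compact
    haveI : CompactSpace D.PiHat := D.isProfiniteCompletion_toHat.compactSpace
    haveI : T2Space D.PiHat := D.isProfiniteCompletion_toHat.t2Space
    haveI : CompactSpace ↥D.deltaHat := isCompact_iff_compactSpace.mp D.isClosed_deltaHat.isCompact
    haveI : IsClosed ((D.ellKerHat.subgroupOf D.deltaHat : Subgroup ↥D.deltaHat) : Set ↥D.deltaHat) :=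
      (Subgroup.isClosed_topologicalClosure _).preimage continuous_subtype_val
    haveI : CompactSpace ↥T := isCompact_iff_compactSpace.mp hTc.isCompact
    -- `e : T ≃* Ẑ` (abstract groups)
    obtain ⟨e⟩ := DeltaEllZHat.nonempty_mulEquiv_zHat_of_coe_eq_closure D T hTset
    -- a compatible system of primitive roots of unity of `K̄`
    haveI : CharZero (AlgebraicClosure K) :=
      charZero_of_injective_algebraMap (algebraMap K (AlgebraicClosure K)).injective
    obtain ⟨ξ, hξ⟩ := cyclotome.exists_generator
      (cyclotome.exists_isPrimitiveRoot_of_isSepClosed (AlgebraicClosure K))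
    -- the discrete logarithms `log_N := level_N ∘ e : T → ℤ/N`
    let lg : ∀ N : ℕ+, ↥T →* Multiplicative (ZMod N) := fun N => (ZHatLevel.level N).comp e.toMonoidHom
    have hlg : ∀ (N : ℕ+) (t : ↥T), lg N t = ZHatLevel.level N (e t) := fun N t => rfl
    -- the level maps `ι'_N (t) := ξ_N ^ log_N t`
    let ι' : ∀ N : ℕ+, ↥T →* (AlgebraicClosure K)ˣ := fun N =>
      { toFun := fun t => (ξ : ℕ+ → (AlgebraicClosure K)ˣ) N ^ (Multiplicative.toAdd (lg N t)).val
        map_one' := by rw [map_one, toAdd_one, ZMod.val_zero, pow_zero]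
        map_mul' := fun s t => by
          rw [map_mul, toAdd_mul, ← pow_add]
          refine cyclotome.pow_val_eq_pow_of_mod_eq (cyclotome.pow_eq_one ξ N) ?_
          rw [ZMod.val_add, Nat.mod_mod] }
    have hι' : ∀ (N : ℕ+) (t : ↥T),
        ι' N t = (ξ : ℕ+ → (AlgebraicClosure K)ˣ) N ^ (Multiplicative.toAdd (lg N t)).val := fun N t => rfl
    -- `ι'_N t = 1 ↔ log_N t = 0`
    have hker : ∀ (N : ℕ+) (t : ↥T), ι' N t = 1 ↔ lg N t = 1 := by
      intro N t
      haveI : NeZero (N : ℕ) := ⟨N.ne_zero⟩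
      rw [hι']
      constructor
      · intro h
        have hdvd := ((hξ N).pow_eq_one_iff_dvd _).mp h
        have hlt : (Multiplicative.toAdd (lg N t)).val < (N : ℕ) := ZMod.val_lt _
        have h0 : (Multiplicative.toAdd (lg N t)).val = 0 := Nat.eq_zero_of_dvd_of_lt hdvd hlt
        rw [ZMod.val_eq_zero] at h0
        rw [← ofAdd_toAdd (lg N t), h0, ofAdd_zero]
      · intro h
        rw [h, toAdd_one, ZMod.val_zero, pow_zero]
    -- `log_N t = 0 ↔ t` is an `N`-th power in `T`
    have hpow : ∀ (N : ℕ+) (t : ↥T), lg N t = 1 ↔ ∃ s : ↥T, s ^ (N : ℕ) = t := by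
      intro N t
      rw [hlg, ZHatLevel.level_eq_one_iff_exists_pow]
      constructor
      · rintro ⟨z, hz⟩
        refine ⟨e.symm z, e.injective ?_⟩
        rw [map_pow, MulEquiv.apply_symm_apply, hz]
      · rintro ⟨s, rfl⟩
        exact ⟨e s, (map_pow e s N).symm⟩
    -- the `ℕ`-indexed family
    let ι : ℕ → (↥T →* (AlgebraicClosure K)ˣ) := fun n => if h : 0 < n then ι' (Nat.toPNat n h) else 1
    have hι : ∀ N : ℕ+, ι (N : ℕ) = ι' N := fun N => by
      simp only [ι, dif_pos N.pos]
      rfl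
    -- torsion `(ι_n t)^n = 1` (used twice)
    have htors : ∀ (N : ℕ+) (t : ↥T), ι N t ^ (N : ℕ) = 1 := fun N t => by
      rw [hι, hι', pow_right_comm, cyclotome.pow_eq_one ξ N, one_pow]
    refine ⟨ι, ?_, ?_, ?_, ?_, ?_, ?_⟩
    · intro n hn t
      obtain ⟨N, rfl⟩ : ∃ N : ℕ+, (N : ℕ) = n := ⟨Nat.toPNat n hn, rfl⟩
      exact htors N t
    · -- surjective onto `μ_n(K̄)`: every `n`-th root of unity is a power of the primitive `ξ_n`
      intro n hn ζ hζ
      obtain ⟨N, rfl⟩ : ∃ N : ℕ+, (N : ℕ) = n := ⟨Nat.toPNat n hn, rfl⟩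
      haveI : NeZero (N : ℕ) := ⟨N.ne_zero⟩
      obtain ⟨i, hi, rfl⟩ := (hξ N).eq_pow_of_mem_rootsOfUnity (ξ := ζ) (by rwa [mem_rootsOfUnity])
      refine ⟨e.symm (ZHatLevel.eta i), ?_⟩
      rw [hι, hι', hlg, MulEquiv.apply_symm_apply, ZHatLevel.level_eta, toAdd_ofAdd, Int.cast_natCast,
        ZMod.val_natCast, Nat.mod_eq_of_lt hi]
    · -- open kernels: `Ker ι_n` is the image of the `n`-th power map — closed, of finite index
      intro n hn
      obtain ⟨N, rfl⟩ : ∃ N : ℕ+, (N : ℕ) = n := ⟨Nat.toPNat n hn, rfl⟩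
      haveI : NeZero (N : ℕ) := ⟨N.ne_zero⟩
      have hset : ((ι N).ker : Set ↥T) = ((lg N).ker : Set ↥T) := by
        ext t
        rw [SetLike.mem_coe, SetLike.mem_coe, MonoidHom.mem_ker, MonoidHom.mem_ker, hι, hker]
      have hrange : ((lg N).ker : Set ↥T) = Set.range fun s : ↥T => s ^ (N : ℕ) := by
        ext t
        rw [SetLike.mem_coe, MonoidHom.mem_ker, hpow, Set.mem_range]
      have hclosed : IsClosed ((lg N).ker : Set ↥T) := by
        rw [hrange]
        exact (isCompact_range (continuous_pow (N : ℕ))).isClosed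
      haveI : (lg N).ker.FiniteIndex := inferInstance
      rw [hset]
      exact Subgroup.isOpen_of_isClosed_of_finiteIndex _ hclosed
    · -- compatibility `(ι_{nm} t)^m = ι_n t`
      intro n m hn hm t
      obtain ⟨N, rfl⟩ : ∃ N : ℕ+, (N : ℕ) = n := ⟨Nat.toPNat n hn, rfl⟩
      obtain ⟨M, rfl⟩ : ∃ M : ℕ+, (M : ℕ) = m := ⟨Nat.toPNat m hm, rfl⟩
      haveI : NeZero (N : ℕ) := ⟨N.ne_zero⟩
      rw [← PNat.mul_coe, hι, hι, hι', hι', pow_right_comm, cyclotome.pow_apply_mul]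
      refine cyclotome.pow_val_eq_pow_of_mod_eq (cyclotome.pow_eq_one ξ N) ?_
      have hc := ZHatLevel.cast_level_mul N M (e t)
      rw [ZMod.castHom_apply, ZMod.cast_eq_val] at hc
      rw [hlg, hlg, ← hc, ZMod.val_natCast]
      exact (Nat.mod_mod _ _).symm
    · -- jointly injective: `Ẑ ↪ lim_n ℤ/n`
      intro t ht
      have h1 : e t = 1 := by
        refine ZHatLevel.ext_of_level fun N => ?_
        rw [map_one, ← hlg, ← hker, ← hι]
        exact ht N N.pos
      exact (map_eq_one_iff e e.injective).mp h1
    · -- equivariance: both sides are `ι_n t`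
      intro n hn g t
      obtain ⟨N, rfl⟩ : ∃ N : ℕ+, (N : ℕ) = n := ⟨Nat.toPNat n hn, rfl⟩
      have hgt : (⟨D.conjDeltaEll g t, hT g t t.2⟩ : ↥T) = t := Subtype.ext (htriv g t)
      rw [hgt, hfix (D.aug g) N N.pos _ (by rw [← Units.val_pow_eq_pow_val, htors N t, Units.val_one])]

/-- **Negative half, any field** (the mechanism of abc-iut-w6-d060's `ℚ₃` refutation `TemperedCyclotomicClosures.lean`,
[EtTh] p. 12 typed package): if `Π^tp_X` acts trivially on `Δ^ell_X` and SOME `σ ∈ Gal(K̄/K)` MOVES some root of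
unity of `K̄`, then the closed subgroup of `Δ^ell_X` with the F-1697 carrier is NOT a Tate twist — so the bodies of
F-1697 / F-0657 / F-0658 / F-0659 fail for this datum. [cite: MochizukiEtTh2009, §1 p.12] -/
theorem not_isTateTwist_of_gal_moves_rootOfUnity [CharZero K]
    (htriv : ∀ (g : D.Pi) (x : D.DeltaEll), D.conjDeltaEll g x = x)
    {σ : Field.absoluteGaloisGroup K} {n : ℕ} (hn : 0 < n) {ζ : AlgebraicClosure K} (hζ : ζ ^ n = 1)
    (hmove : OncePuncturedTemperedGroup.galApply σ ζ ≠ ζ)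
    (T : Subgroup D.DeltaEll) (hT : ∀ g, ∀ t ∈ T, D.conjDeltaEll g t ∈ T) (hTc : IsClosed (T : Set D.DeltaEll))
    (hTset : (T : Set D.DeltaEll) = closure ((fun δ : D.delta =>
      (QuotientGroup.mk ⟨D.toHat δ, Subgroup.le_topologicalClosure _ ⟨δ, δ.2, rfl⟩⟩ : D.DeltaEll)) ''
        {δ | (δ : D.Pi) ∈ D.piY})) :
    ¬ D.IsTateTwist T D.conjDeltaEll hT := fun h =>
  hmove ((isTateTwist_iff_gal_fixes_rootsOfUnity_of_conjDeltaEll_eq_self D htriv T hT hTc hTset).mp h σ n hn ζ hζ)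

/-- **Positive half, any field** ([EtTh] p. 12 typed package; generalises the `G_K = 1` witness of
`Sec1CyclotomicPackageTrivialGalois.lean`): if `Π^tp_X` acts trivially on `Δ^ell_X` and every `σ ∈ Gal(K̄/K)` fixes every
root of unity of `K̄` (characteristic `0`), then the closure of the image of `Δ^tp_Y` in `Δ^ell_X` IS a closed
`Π^tp_X`-stable Tate twist: the body of F-1697 holds for this datum. [cite: MochizukiEtTh2009, §1 p.12] -/
theorem exists_isTateTwist_closureDeltaY_of_gal_fixes_rootsOfUnity [CharZero K]
    (htriv : ∀ (g : D.Pi) (x : D.DeltaEll), D.conjDeltaEll g x = x)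
    (hfix : ∀ (σ : Field.absoluteGaloisGroup K) (n : ℕ), 0 < n → ∀ ζ : AlgebraicClosure K, ζ ^ n = 1 →
      OncePuncturedTemperedGroup.galApply σ ζ = ζ) :
    ∃ (T : Subgroup D.DeltaEll) (hT : ∀ g, ∀ t ∈ T, D.conjDeltaEll g t ∈ T),
      IsClosed (T : Set D.DeltaEll) ∧ D.IsTateTwist T D.conjDeltaEll hT ∧
      (T : Set D.DeltaEll) = closure ((fun δ : D.delta =>
        (QuotientGroup.mk ⟨D.toHat δ, Subgroup.le_topologicalClosure _ ⟨δ, δ.2, rfl⟩⟩ : D.DeltaEll)) ''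
          {δ | (δ : D.Pi) ∈ D.piY}) := by
  obtain ⟨T, hT, hTc, hTset⟩ := exists_closed_stable_closureDeltaY D
  exact ⟨T, hT, hTc,
    (isTateTwist_iff_gal_fixes_rootsOfUnity_of_conjDeltaEll_eq_self D htriv T hT hTc hTset).mpr hfix, hTset⟩

end OncePuncturedCyclotomic

end Literature.AnabelianGeometry.EtaleTheta

end
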